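import Literature.Probability.Percolation.KozmaNitzanTheorem6
import Literature.Probability.LatticeModels.RandomClusterEdgeWeightsConditioning
import Summits.CriticalPhenomena.PercolationContinuityZ3.Theorems.FK.InfiniteVolumeDefs
import HarnessLib

/-!
# The free-boundary hypothesis `FH` and the binder vocabulary of the conditional Kozma–Nitzan transplant (FT-01)

**CONDITIONAL on `FH` (open at the same `p` for `q > 1`; ⇔ GRC Conj. (5.103) via K1); a typed
reduction, not a proof of FK continuity.** Builds on p205010 (kernel theorem, internal audit signed;
external expert review pending).

Barrier note cited first (FBN-01): `Literature.Barriers.CriticalPhenomena.SamePFreeBoundaryCriteria`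
(being landed by fkp-barrier). Calibration K1, verbatim: "[C3a ∀ p > p_c(q)] ∧ C3b ⇒ p̂_c(q) = p_c(q) =
GRC Conj (5.103) = DT Question 5 (open for q ∈ (1,2))". Wording of record (R14(d)): CONDITIONAL on
FH := free-box hittability of the Kozma–Nitzan quarter-face geometry from a wired central seed under the
free random-cluster measure (KN Lemma 9 geometry with free boundary condition). FH is OPEN for `q > 1` at
the same `p` (over `p > p_c(q)` it is GRC Conj. (5.103) / Duminil-Copin–Tassion Q5 territory, K1); it
FAILS at `p_c(q)` wherever `θ⁰(p_c(q), q) = 0`; at `q = 1` it is a theorem for `p > p_c` (KN Lemma 9,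
tree `KozmaNitzan.isHittable_qfGeom`) and false at `p_c`. It is NEVER discharged, cited or mirrored in
`Literature/` by this sub-cell (it is a hypothesis binder of the record theorem
`ufsc0_of_freeBoundaryHypothesis_r0`, file `FreeBoundaryTransplant.lean`).

T1⁺ (no ambient thresholds): every constant below (`k, ℓ₀, m, R, r, δ, δ₂`) is a functional of
FINITE-VOLUME laws `fkLaw Λ W q` of explicitly named weightings — never of `θ⁰(p,q)`, `φ⁰_{p,q}` or any
infinite-volume quantity; `r` is obtained through these laws in the transplant, never from `θ`.

## What this file is

The STATEMENT LAYER of the transplant of Kozma–Nitzan's Theorem 6 engine (arXiv:2401.12397, §4,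
pp. 16–31; tree files `Literature/Probability/Percolation/KozmaNitzan*.lean`, all at `q = 1`) to the
random-cluster model with FREE boundary conditions at the SAME `p`. One law for the whole transplant:

* `fkLaw Λ W q` — the random-cluster measure with edge parameters `W` (tree `rcMeasureW`, Grimmett 2006
  eq. (1.20)) of the finite piece `Λ ⊆ ℤ^d`, read on bond configurations of `ℤ^d` (pushforward under
  `liftEdges` of `InfiniteVolumeDefs.lean` — imported for this one decl; no infinite-volume object
  (`rcLimit`, `IsBoxLimit`, `FKGibbs`) is in the cone of anything here, A7). Boundary conditions are ENCODED IN THE WEIGHTS, exactly as in KN's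
  pinning device (`KozmaNitzanPinning.lean`): a revealed-open edge has weight `1` (= wired), a
  revealed-closed or deleted edge weight `0` (= free/absent), a fresh lattice edge weight `p`; conditioning
  on a revealed pattern = pinning (Grimmett 2006 Thm. (3.7); tree `condWeights`,
  `rcMeasureW_real_inter_cylinder`). Hence every MEASURE-FREE declaration of the KN files (`Geom`, `Qset`,
  `Fset`, `linkIn`, `IsTarget`, `IsSubbox`, `FinSupp`, `pairsF`, `CData`, `Cells`, `KSch`, `Wt`, `W₀`,
  `Wfull`, `Conn`, `Sx`, `onward`, …) is reused VERBATIM, and every Prop below is the LAW-SWAPPED TWIN of a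
  named tree declaration (`prodBernoulli W` ↦ `fkLaw Sfin W q`).

* The hypothesis of record `FH` (R14(a): the centred form `FHcen`) and the launch-consumption Prop
  `FKLaunchAt` (R14(b)(1)): the ONLY form in which any binder consumes hittability — the hitting box
  `v + ℓQ` carries no revealed-closed edge (its inside weights dominate the free-look weighting: lattice
  `p`, seed `v + Λ_m` wired), the environment outside the box is an arbitrary finitely supported
  weighting. Wall-type variants (`FH` of gen 2 = `FHpatch`, `FHwall`, `FHcorner` — wall-type: at `q = 1`,
  `W(p,1) ⇒ θ_ℍ(p) > 0`; false at `(1, p_c)` by BGN; `PenetrationShape W ⇔ PercolationContinuityZ3`;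
  never a binder of record, never a G-T2 target) are typed in the scratch file
  `prim-bschramm-fkp-18b/FreeBoundaryInputs.lean` (v2, farm rc 0) and are NOT part of this layer;
  `FB1` is withdrawn context only; there is no trace-quantified `FB2` (refuted-misstated, refuter F1)
  and no `FB3` (R12).

* The PROVE binders of `_r0` (each a closed `Prop`, discharged verbatim by its owner seat and installed
  by a re-cut `_r1, _r2, …`): `KNFreeLaunchBound` (FH ⇒ launchability of the quarter faces; DM + MON),
  `KNFreeTargetProperty` (FK twin of tree `TargetProperty`, KN Lemma 10), `KNFreeElongatedLaunch`
  (KN Lemma 11), `KNFreeCorridorBound` (FK twin of `CData.corridorLemma_of_target`, KN Lemma 12),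
  `KNFreeOriginBound` (FK twin of `KSch.hQ0_of_hit`, (32) at the origin), `KNFreeBadBound` (FK twin of
  `KSch.real_bad_le`, (33)/(36)–(37) per direction under the minimal law `P^x`, refuter F4).

* `UFSC0 d q p r ε₀` — the uniform finite-size criterion at scale `r`: the two hypotheses of tree
  `KSch.lawful` ((32) at the origin, (33) after valid histories) in FK per-direction minimal-law form.
  (Typed here because `ContinuityCruxDefs.lean` (FO-05) has not landed; FO-05 imports this def.)

## References

* G. Kozma, S. Nitzan, arXiv:2401.12397 (2024), §4 (Lemmas 9–12, Theorem 6, pp. 16–31) [KozmaNitzan2024].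
* G. Grimmett, *The Random-Cluster Model*, Springer 2006, eq. (1.20), Thm. (3.7), §4.2, Conj. (5.103) [Grimmett2006].
* H. Duminil-Copin, V. Tassion, arXiv:1502.03050, Question 5.
-/

noncomputable section

open MeasureTheory
open scoped ENNReal Classical

namespace Summit.CriticalPhenomena.PercolationContinuityZ3.Theorems.FK

open Literature.Probability.Percolation Literature.Probability.LatticeModels SimpleGraph
open Literature.Probability.Percolation.GadgetSystem Literature.Probability.Percolation.KozmaNitzan

variable {d : ℕ}

/-! ## The one law of the transplant -/

/-- **The FK law of a weighting on a finite piece**: the random-cluster measure with edge parameters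
`W` (restricted to the pairs of `Λ`), cluster weight `q` and no wired set, on the finite vertex type
`↥Λ`, pushed forward to bond configurations of `ℤ^d` by `liftEdges` (`InfiniteVolumeDefs.lean`; edges off
`Λ` closed). Boundary conditions live in `W`: weight `1` =
wired/revealed-open, weight `0` = deleted/revealed-closed, `p` = fresh lattice edge.
[cite: Grimmett2006, §1.4 eq. (1.20) (p. 15), Thm. (3.7)] -/
def fkLaw (Λ : Finset (Site d)) (W : Sym2 (Site d) → unitInterval) (q : ℝ) : Measure (BondConfig (Site d)) :=
  (rcMeasureW (fun e : Sym2 ↥Λ => W (Sym2.map Subtype.val e)) q (∅ : Set ↥Λ)).map (liftEdges Λ)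

/-! ## The hypothesis of record `FH` and the launch-consumption Prop -/

/-- The free-look weighting of the hitting box `v + ℓQ` with seed `v + Λ_m`: lattice weight `p` on the
lattice edges inside `v + ℓQ`, weight `1` on the lattice edges inside the seed `v + Λ_m` (wired seed),
`0` on every other pair (free boundary condition on `v + ℓQ`). [cite: KozmaNitzan2024, §4 p. 16 (hittable geometry), read under φ⁰ with a wired seed] -/
def hitW (p : unitInterval) (g : Geom d) (ℓ m : ℕ) (v : Site d) : Sym2 (Site d) → unitInterval :=
  restrW (↑(g.Qset ℓ v) : Set (Site d))
    (pinW (lattW d p) ↑(edgesIn (zdGraph d) (GM.ball v m)) ↑(edgesIn (zdGraph d) (GM.ball v m)))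

/-- **FK-hittable geometry** (the b.c.-typed twin of tree `KozmaNitzan.IsHittable`, KN p. 16): for every
`ε > 0`, from some seed size `k` and scale `ℓ₀` on, for ALL `m ≥ k`, `ℓ ≥ ℓ₀`, under the FREE random-cluster
law of `ℓQ` with the central seed `Λ_m` wired, `Λ_m` is joined to `ℓF` inside `ℓQ` with probability
`> 1 - ε`. Thresholds after `ε` (T1⁺). [cite: KozmaNitzan2024, §4 p. 16 (Definition of a hittable geometry); Grimmett2006, Conj. (5.103)] -/
structure IsHittableFK (q : ℝ) (p : unitInterval) (g : Geom d) : Prop where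
  hit : ∀ ε : ℝ, 0 < ε → ∃ k ℓ₀ : ℕ, ∀ m, k ≤ m → ∀ ℓ, ℓ₀ ≤ ℓ →
    1 - ε < (fkLaw (g.Qset ℓ 0) (hitW p g ℓ m 0) q).real (linkIn (↑(g.Qset ℓ 0)) (GM.ball 0 m) (g.Fset ℓ 0))

/-- **`FH d q p` — THE HYPOTHESIS OF RECORD** (R14(a), centred form `FHcen`): every quarter-face
geometry of `ℤ^d` (tree `qfList d`, KN's `H` of Lemma 9) is FK-hittable at `(q, p)` under the free
measure with a wired central seed. OPEN for `q > 1` at the same `p`; at `q = 1` it is KN Lemma 9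
(tree `isHittable_of_mem_qfList`). Never discharged in this sub-cell (K1). [cite: KozmaNitzan2024, §4 Lemma 9 (p. 16); Grimmett2006, Conj. (5.103)] -/
@[conjecture] def FH (d : ℕ) (q : ℝ) (p : unitInterval) : Prop :=
  ∀ g ∈ qfList d, IsHittableFK q p g

/-- **The launch-consumption Prop** (R14(b)(1); the ONLY form in which the transplant consumes
hittability): for EVERY finitely supported weighting `W` on `Sfin ⊇ v + ℓQ` whose values on the pairs
INSIDE the hitting box `v + ℓQ` dominate the free-look weighting `hitW` (so: the box carries no
revealed-closed edge; revealed-open edges anywhere and an arbitrary pinned environment OUTSIDE the box are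
allowed), the seed `v + Λ_m` is joined to `v + ℓF` inside `v + ℓQ` with `fkLaw`-probability `> 1 - δ`.
The measure is `fkLaw Sfin W q` (b.c. = the weighting `W`, named). [cite: KozmaNitzan2024, §4 p. 16 (target: v + ℓQ ⊆ D), p. 22 (Step V); Grimmett2006, Lemma (4.14) (comparison of boundary conditions)] -/
def FKLaunchAt (d : ℕ) (q : ℝ) (p : unitInterval) (g : Geom d) (δ : ℝ) (m ℓ : ℕ) : Prop :=
  ∀ (W : Sym2 (Site d) → unitInterval) (Sfin : Finset (Site d)) (v : Site d),
    FinSupp W Sfin → g.Qset ℓ v ⊆ Sfin →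
    (∀ e ∈ pairsF (g.Qset ℓ v), hitW p g ℓ m v e ≤ W e) →
      1 - δ < (fkLaw Sfin W q).real (linkIn (↑(g.Qset ℓ v)) (GM.ball v m) (g.Fset ℓ v))

/-- **FK-launchable geometry**: the `∀ δ ∃ k ℓ₀` closure of `FKLaunchAt` (environment-robust
hittability, thresholds after `δ`). [cite: KozmaNitzan2024, §4 p. 16; Grimmett2006, Lemma (4.14)] -/
def IsLaunchableFK (q : ℝ) (p : unitInterval) (g : Geom d) : Prop :=
  ∀ δ : ℝ, 0 < δ → ∃ k ℓ₀ : ℕ, ∀ m, k ≤ m → ∀ ℓ, ℓ₀ ≤ ℓ → FKLaunchAt d q p g δ m ℓ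

/-! ## The FK examination: law-swapped twins of `KSch.cond`, `KSch.bad`, `KSch.Valid`, (32) at the origin -/

section Scheme

variable (S : KSch d) (q : ℝ)

/-- **(30)-FK**: the connection `v–x` is good at level `j` given the observation `o` — under the
MINIMAL law `P^x` of the direction (weighting `Wt` = lattice pinned on `ω|_D`, restricted to
`D ∪ E_{v,x}`; law `fkLaw` on `Sx = E_i ∪ E_{w,v} ∪ E_{v,x}`), `0 ↔ M_x` has probability `> 1 - δ`.
Twin of tree `KSch.cond`. [cite: KozmaNitzan2024, §4 p. 27 ((30))] -/
def condFK (h : ProbeHistory (Site d)) (e : Site 2 × MDir) (du : MDir) (j : ℕ) (o : Finset (Sym2 (Site d))) : Prop :=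
  1 - S.δc < (fkLaw (S.Sx h e du) (S.Wt h e du j o) q).real (S.Conn e du)

/-- **A bad direction (FK)**: the connection `v–x` is good at no level. Twin of tree `KSch.bad`.
[cite: KozmaNitzan2024, §4 p. 27 (j_x), p. 31] -/
def badFK (h : ProbeHistory (Site d)) (e : Site 2 × MDir) (du : MDir) : Set (BondConfig (Site d)) :=
  {ω | ∀ j < S.C.K, ¬condFK S q h e du j (obs ω (S.env h e))}

/-- **Valid histories (FK)**: tree `KSch.Valid` with the estimate (32) read under the FK law of the
weighting `W₀` (pinned on `ω|_{E_i}`, restricted to `E_i ∪ E_{w,v}`) on `E_i ∪ E_{w,v}`.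
[cite: KozmaNitzan2024, §4 pp. 26–28 ((29), (31), (32))] -/
structure ValidFK (h : ProbeHistory (Site d)) (e : Site 2 × MDir) : Prop where
  F_eq : S.F h = edgesIn (zdGraph d) (S.V h)
  ξ_sub : S.ξ h ⊆ S.F h
  zero_mem : (0 : Site d) ∈ S.V h
  src_mem : S.C.cen e.1 ∈ S.V h
  cover : ∃ det : Set (Site 2), tgt e ∉ det ∧ (∀ du ∈ S.onward h (tgt e), tgt e + stepVec du ∉ det) ∧
    (↑(S.V h) : Set (Site d)) ⊆ S.C.Cover det
  reach : 1 - S.δc < (fkLaw (S.V h ∪ S.C.Ewv e.1 e.2) (S.W₀ h e) q).real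
    (⋃ t ∈ S.C.M (tgt e), openConn (0 : Site d) t)

/-- **(32) at the origin (FK)** in the onward direction `du`: under the FK law on `Q_0 ∪ E_{0,v}` of the
lattice weighting with the edges of `Q_0` wired open, `0` is joined to `M_v` inside `Q_0 ∪ E_{0,v}`
with probability `> 1 - δ`. Twin of the conclusion of tree `KSch.hQ0_of_hit`.
[cite: KozmaNitzan2024, §4 p. 28 ((32) for w = 0)] -/
def OriginFK (du : MDir) : Prop :=
  1 - S.δc < (fkLaw (S.C.Q 0 ∪ S.C.Ewv 0 du)
      (restrW (↑(S.C.Q 0 ∪ S.C.Ewv 0 du) : Set (Site d)) (pinW (lattW d S.p) ↑S.U₀ ↑S.U₀)) q).real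
    (⋃ t ∈ (↑(S.C.M ((0 : Site 2) + stepVec du)) : Set (Site d)),
      openConnIn (↑(S.C.Q 0 ∪ S.C.Ewv 0 du) : Set (Site d)) 0 t)

end Scheme

/-! ## The uniform finite-size criterion -/

/-- **`UFSC0 d q p r ε₀` — the uniform finite-size criterion at scale `r`** (free b.c., same `p`):
there is a Kozma–Nitzan examination scheme `S` at parameter `p` and scale `r = K·s`, threshold
`0 < δ ≤ 1`, such that (32)-FK holds at the origin in every direction and, after every FK-valid history,
in every onward direction the bad event has MINIMAL-LAW probability at most `ε₀` (the law `P^x`: weighting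
`Wfull` = lattice pinned on `ω|_{E_i}` restricted to `E_i ∪ E_{w,v} ∪ E_{v,x}`, on `Sx`). These are the
two hypotheses of tree `KSch.lawful` in FK per-direction form; the run (C3b) sums ≤ 4 directions.
[cite: KozmaNitzan2024, §4 pp. 25–31 ((32), (33)); Grimmett2006, Conj. (5.103)] -/
def UFSC0 (d : ℕ) (q : ℝ) (p : unitInterval) (r : ℕ) (ε₀ : ℝ) : Prop :=
  ∃ S : KSch d, S.p = p ∧ S.C.r = r ∧ 0 < S.δc ∧ S.δc ≤ 1 ∧ (∀ du : MDir, OriginFK S q du) ∧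
    ∀ (h : ProbeHistory (Site d)) (e : Site 2 × MDir) (du : MDir), ValidFK S q h e →
      du ∈ S.onward h (tgt e) → (fkLaw (S.Sx h e du) (S.Wfull h e du) q).real (badFK S q h e du) ≤ ε₀

/-! ## The PROVE binders of `_r0` -/

/-- **The target inequality at thresholds `(δ, ε)` for the geometries `H` and inflation `R`** (FK twin of
the matrix of tree `TargetProperty` / `KSch.fail_bound`'s `htgt`): for every finitely supported
weighting `W` with a lattice subbox `D` at `p`, source `o ∉ D`, box `B = Icc lo hi` with `B⟨R⟩ ⊆ D` and
target `T` w.r.t. `(B, D, R, H)`: `P(o ↔ B) > 1 - δ ⟹ P(o ↔ T) > 1 - ε`, `P = fkLaw Sfin W q`.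
[cite: KozmaNitzan2024, §4 Lemma 10 (pp. 17–22)] -/
def FKTargetAt (d : ℕ) (q : ℝ) (p : unitInterval) (δ ε : ℝ) (H : List (Geom d)) (R : ℕ) : Prop :=
  ∀ (W : Sym2 (Site d) → unitInterval) (Sfin D : Finset (Site d)) (lo hi : Site d)
    (T : Finset (Site d)) (o : Site d),
    FinSupp W Sfin → IsSubbox W p D → D ⊆ Sfin → o ∈ Sfin → o ∉ D →
    Finset.Icc (lo - (R : Site d)) (hi + (R : Site d)) ⊆ D →
    IsTarget T lo hi D R H → T ⊆ D → T.Nonempty →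
    1 - δ < (fkLaw Sfin W q).real (⋃ b ∈ Finset.Icc lo hi, openConn o b) →
      1 - ε < (fkLaw Sfin W q).real (⋃ t ∈ T, openConn o t)

/-- **PROVE binder `h_launch` — launchability of the quarter faces from `FH`**: the free look is the
worst environment (domain Markov + comparison of boundary conditions for the increasing event `linkIn`,
`q ≥ 1`; translation to base point `v`; monotonicity in the weights inside the box). Owner fkt-p3.
[cite: Grimmett2006, Lemma (4.14), Thm. (3.21) (comparison inequalities); KozmaNitzan2024, §4 p. 16] -/
@[conjecture] def KNFreeLaunchBound (d : ℕ) (q : ℝ) (p : unitInterval) : Prop :=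
  FH d q p → ∀ g ∈ qfList d, IsLaunchableFK q p g

/-- **PROVE binder `h_tgt` — the FK target property** (KN Lemma 10 for `fkLaw`, hittability consumed as
LAUNCHABILITY): `∀ ε ∃ δ ∀ H launchable ∃ R`, the target inequality. FK twin of tree `TargetProperty`
(whose `q = 1` instance is tree `targetProperty_of_theta_pos`). Route: seed manufacture (Lemma 10 Steps
II–III with two-sided finite energy) + set-target FK gluing (`FKSetTargetGluing.lean`, p243470) in place
of Conjecture 3. Owner fkt-p1. [cite: KozmaNitzan2024, §4 Lemma 10 (pp. 17–22); Grimmett2006, Thm. (3.7), eq. (3.4) (finite energy)] -/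
@[conjecture] def KNFreeTargetProperty (d : ℕ) (q : ℝ) (p : unitInterval) : Prop :=
  ∀ ⦃ε : ℝ⦄, 0 < ε → ∃ δ : ℝ, 0 < δ ∧ ∀ H : List (Geom d), (∀ g ∈ H, IsLaunchableFK q p g) →
    ∃ R : ℕ, FKTargetAt d q p δ ε H R

/-- **PROVE binder `h_elong` — KN Lemma 11 for `fkLaw`**: launchable quarter faces and the FK target
property make every elongated geometry `[-1,1]^d → face of aspect K` (tree `elongList d K`) launchable.
FK twin of tree `isHittable_of_mem_elongList_of_target`. Owner fkt-p2.
[cite: KozmaNitzan2024, §4 Lemma 11 (p. 22)] -/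
@[conjecture] def KNFreeElongatedLaunch (d : ℕ) (q : ℝ) (p : unitInterval) : Prop :=
  (∀ g ∈ qfList d, IsLaunchableFK q p g) → KNFreeTargetProperty d q p →
    ∀ (K : ℕ) (hK : 2 ≤ K), ∀ g ∈ elongList d K (by omega), IsLaunchableFK q p g

/-- **The corridor inequality at thresholds `(δ, ε)` from scale `m` on** (FK twin of the matrix of tree
`CData.corridorLemma_of_target` / `KSch.real_bad_le`'s `hcorr`): for every corridor datum `T` with
`T.Hyp p` and `m ≤ T.r`, `P(o ↔ c + [-3r,3r]^d inside A) > 1 - δ ⟹ P(o ↔ far face inside U) > 1 - ε`,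
`P = fkLaw T.Sfin T.W q`. [cite: KozmaNitzan2024, §4 Lemma 12 (pp. 23–25)] -/
def FKCorridorAt (d : ℕ) (q : ℝ) (p : unitInterval) (δ ε : ℝ) (m : ℕ) : Prop :=
  ∀ T : CData d, T.Hyp p → m ≤ T.r →
    1 - δ < (fkLaw T.Sfin T.W q).real
        (⋃ b ∈ Finset.Icc (T.c - ((3 * T.r : ℕ) : Site d)) (T.c + ((3 * T.r : ℕ) : Site d)),
          openConnIn (↑T.Aset : Set (Site d)) T.o b) →
      1 - ε < (fkLaw T.Sfin T.W q).real (⋃ b ∈ T.Tn (3 * T.r), openConnIn (↑T.Uset : Set (Site d)) T.o b)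

/-- **PROVE binder `h_corr` — KN Lemma 12 for `fkLaw`**: `∀ ε ∃ δ ∃ m`, the corridor inequality, from
launchable quarter faces and the FK target property (the `d` inward halving steps and the corridor step,
p. 24, each a target-property instance inside an unrevealed subbox). FK twin of tree
`CData.corridorLemma_of_target`. Owner fkt-p2. [cite: KozmaNitzan2024, §4 Lemma 12 (pp. 23–25)] -/
@[conjecture] def KNFreeCorridorBound (d : ℕ) (q : ℝ) (p : unitInterval) : Prop :=
  (∀ g ∈ qfList d, IsLaunchableFK q p g) → KNFreeTargetProperty d q p →
    ∀ ⦃ε : ℝ⦄, 0 < ε → ∃ δ : ℝ, 0 < δ ∧ ∃ m : ℕ, FKCorridorAt d q p δ ε m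

/-- **PROVE binder `h_orig` — (32) at the origin from one launch** (FK twin of tree `KSch.hQ0_of_hit`):
the launch of the aspect-`6` elongated geometry at scale `3r` from the seed `Λ_{3r}` at threshold `δ`, read
in the environment `Q_0` wired (weights dominate the free look inside the box; `U₀` is a.s. open), gives
(32)-FK at the origin. Owner fkt-p3. [cite: KozmaNitzan2024, §4 p. 28 ((32) for w = 0)] -/
@[conjecture] def KNFreeOriginBound (d : ℕ) (q : ℝ) (p : unitInterval) : Prop :=
  ∀ S : KSch d, S.p = p → ∀ du : MDir,
    FKLaunchAt d q S.p (elongGeom (S.C.axOf du) (σu du) 6 (by norm_num)) S.δc (3 * S.C.r) (3 * S.C.r) →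
      OriginFK S q du

/-- **PROVE binder `h_bad` — (36)–(37) for one direction under the minimal law `P^x`** (FK twin of tree
`KSch.real_bad_le`, KN Steps II–IV pp. 28–31): after an FK-valid history, given the corridor inequality at
`(δ, ε')` from scale `r` on and the target inequality at `(δ₂, δ)` for the aspect-`2K` elongated geometries
with `2R ≤ s`, the bad event of direction `x` has `P^x`-probability `≤ (1 - δ₂)^K + ε'`
(`P^x = fkLaw Sx Wfull q`; the tower identities (36)–(37) are exact under `P^x`, conditioning = pinning,
Grimmett Thm. (3.7); contacts by two-sided finite energy). Owner fkt-p4.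
[cite: KozmaNitzan2024, §4 pp. 28–31 ((33), (36), (37)); Grimmett2006, Thm. (3.7)] -/
@[conjecture] def KNFreeBadBound (d : ℕ) (q : ℝ) (p : unitInterval) : Prop :=
  ∀ S : KSch d, S.p = p → ∀ ⦃ε' δ₂ : ℝ⦄, δ₂ ≤ 1 → ∀ ⦃R : ℕ⦄,
    FKCorridorAt d q S.p S.δc ε' S.C.r →
    FKTargetAt d q S.p δ₂ S.δc (elongList d (2 * S.C.K) (by have := S.C.hK; omega)) R →
    2 * R ≤ S.C.s →
    ∀ (h : ProbeHistory (Site d)) (e : Site 2 × MDir) (du : MDir), ValidFK S q h e →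
      du ∈ S.onward h (tgt e) →
        (fkLaw (S.Sx h e du) (S.Wfull h e du) q).real (badFK S q h e du) ≤ (1 - δ₂) ^ S.C.K + ε'


end Summit.CriticalPhenomena.PercolationContinuityZ3.Theorems.FK

end
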